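import Summits.CriticalPhenomena.SAWScalingLimit.Theorems.SAWLeftRightFKGFKGToTraversalBoundKilledWalkCollarPassage
import Summits.CriticalPhenomena.SAWScalingLimit.Theorems.SAWLeftRightFKGFKGToTraversalBoundKilledWalkCollarWall
import HarnessLib

/-!
# The far detour of the killed walk behind a collar costs at most `ε(M) · G_Λ(b,b)`

Support file for stub `stub_killedWalkCollarBound` (line `excursion-domination`, crux `FKGToTraversalBound`,
stmt-CriticalPhenomena-1878, route `SAWLeftRightFKG`): the part of the killed-walk collar bound that the
tree's weak Beurling estimate settles, assembled as the registered worker sub-goal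
`stub_killedWalkFarDetour` (§5): under the collar clauses of the registered signature (hole-free `Λ`,
collar `V` in the annulus `r ≤ |δx - z₀| ≤ R` with `δ ≤ r`, `M r ≤ R`, `M > 2`, near component of
`a ∋ b`, dead end `H`, wall site within `r + δ` of `z₀`, two-sided mouth condition in either
orientation),
  `G_Λ(a,b) - G_{Λ∖H}(a,b) ≤ ε(M) G_Λ(b,b)` and `G_Λ(b,b) - G_{Λ∖H}(b,b) ≤ ε(M) G_Λ(b,b)`,
  `ε(M) = C_B (12/(M-2))^{β_B} → 0`
(`C_B = beurlingConst`, `β_B = beurlingExp` of `WeakBeurlingEstimate.lean`). The second inequality is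
the DIAGONAL case `a = b` of the stub (`G_{Λ∖H}(b,b) ≥ (1 - ε) G_Λ(b,b)`); the first says that the
`a → b` detour through the dead end carries Green mass at most `ε G_Λ(b,b)` — what remains open for the
stub is `G_Λ(a,b)` in place of `G_Λ(b,b)` on the right (the two-way crossing of the collar by the walk
conditioned to hit `b`, Kemppainen–Smirnov 2017 Thm. 4.12 / Prop. 2.5; see `…KilledWalkCollarBound.lean`).

Proof (§4): with `F` the far set (sites joined off `V` to `H`; `H ∩ Λ ⊆ F`, so `G_{Λ∖H} ≥ G_{Λ∖F}`)
and `N ∋ a, b` the near set, the correction `u = G_Λ(·,b) - G_{Λ∖F}(·,b)` is harmonic on `Λ ∖ F`,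
`0 ≤ u ≤ G_Λ(b,b)`, `u = 0` off `Λ`. OUTER dead end (first disjunct): `u` vanishes on `∂(Λ ∖ F)`
inside radius `R` (the entrances of `F` lie beyond `R`), so `u ≤ ε G_Λ(b,b)` within `r + δ` of `z₀`
by the wall estimate of `…KilledWalkCollarWall.lean`, in particular on the collar sites adjacent to `N`,
and the maximum principle on `N` concludes. INNER dead end (second disjunct): `G_Λ(·,b)/G_Λ(b,b)` is
harmonic on `Λ ∖ N` and vanishes on its boundary inside radius `R` (the exits of `N` lie beyond `R`),
so `G_Λ(z,b) ≤ ε G_Λ(b,b)` at the entrances `z` of `F` (radius `< r`), and the maximum principle on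
`Λ ∖ F` bounds `u` by its boundary values `G_Λ(z,b)`. Everything is proved; no named fact. [folklore]
-/

noncomputable section

open SimpleGraph
open Literature.Probability.LatticeModels
open Literature.Probability.LatticeModels.WeakBeurling (beurlingConst beurlingExp beurlingConst_pos
  beurlingExp_pos mem_latticeOuterBoundary_iff)

namespace Summit.CriticalPhenomena.SAWScalingLimit.Theorems.FKGToTraversalBound.ExcursionDomination.KilledWalkCollar

/-! ## §4 The far correction `G_Λ(·,b) - G_{Λ∖F}(·,b)` is at most `ε(M) G_Λ(b,b)` on the near side -/

/-- **Outer dead end.** Let `Λ` be hole-free with a wall site within `r + δ` of `z₀`, `F` a set of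
sites all of whose `Λ`-neighbours outside `F` see it beyond radius `R` (`R < |δz - z₀|` for `z ∈ F`
adjacent to `Λ ∖ F`), and `N ⊆ Λ ∖ F` a set all of whose `Λ`-neighbours outside `N` lie off `F` and
within `r + δ` of `z₀`. Then `G_Λ(x,b) - G_{Λ∖F}(x,b) ≤ ε(M) G_Λ(b,b)` for every `x ∈ N` and every
`b`: the correction is harmonic on `Λ ∖ F`, bounded by `G_Λ(b,b)`, and vanishes on `∂(Λ ∖ F)` inside
radius `R`, so it is `≤ ε G_Λ(b,b)` within `r + δ` of the centre (`le_near_wall`), in particular on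
`∂N ∩ Λ`; and it vanishes on `∂N ∖ Λ` (maximum principle on `N`). [folklore] -/
theorem sub_sdiff_le_of_outer {δ r R M : ℝ} {Λ F N : Finset (Site 2)} (hΛ : HoleFree (↑Λ : Set (Site 2)))
    {z₀ : ℂ} {p : Site 2} (hp : p ∉ Λ) (hpz : dist (meshPoint δ p) z₀ ≤ r + δ)
    (hδ : 0 < δ) (hr : δ ≤ r) (hM : 2 < M) (hR : M * r ≤ R) (hN : N ⊆ Λ \ F)
    (hFentr : ∀ z ∈ F, ∀ x ∈ Λ, x ∉ F → (zdGraph 2).Adj x z → R < dist (meshPoint δ z) z₀)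
    (hNmouth : ∀ y ∈ N, ∀ w ∈ Λ, w ∉ N → (zdGraph 2).Adj y w → w ∉ F ∧ dist (meshPoint δ w) z₀ < r + δ)
    (b : Site 2) {x : Site 2} (hx : x ∈ N) :
    dirichletGreen Λ x b - dirichletGreen (Λ \ F) x b ≤
      beurlingConst * (12 / (M - 2)) ^ beurlingExp * dirichletGreen Λ b b := by
  set ε : ℝ := beurlingConst * (12 / (M - 2)) ^ beurlingExp with hε
  set u : Site 2 → ℝ := fun x => dirichletGreen Λ x b - dirichletGreen (Λ \ F) x b with hu
  have hG0 := dirichletGreen_nonneg two_pos Λ b b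
  have hu_harm : IsLatticeHarmonicOn u ↑(Λ \ F) := isLatticeHarmonicOn_dirichletGreen_sub Finset.sdiff_subset b
  have hu_le : ∀ w, u w ≤ dirichletGreen Λ b b := fun w => by
    have := dirichletGreen_nonneg two_pos (Λ \ F) w b
    have := dirichletGreen_le_diag Λ w b
    simp only [hu]; linarith
  have hu_off : ∀ w, w ∉ Λ → u w = 0 := fun w hw => by
    simp only [hu, dirichletGreen_of_not_mem_left Λ hw, dirichletGreen_of_not_mem_left (Λ \ F)
      (fun h => hw (Finset.mem_sdiff.1 h).1), sub_zero]
  -- Step 1: `u ≤ ε G(b,b)` on `Λ ∖ F` within `r + δ` of the centre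
  have step1 : ∀ w ∈ Λ \ F, dist (meshPoint δ w) z₀ < r + δ → u w ≤ ε * dirichletGreen Λ b b := by
    intro w hw hwd
    rcases hG0.lt_or_eq with hGpos | hG0'
    · have key := le_near_wall hΛ (T := ↑(Λ \ F)) (fun y hy => (Finset.mem_sdiff.1 hy).1)
        (h := fun y => u y / dirichletGreen Λ b b) ?_ ?_ ?_ hp hpz hδ hr hM hR (x := w) hw hwd
      · rwa [div_le_iff₀ hGpos] at key
      · intro y hy
        rw [show (fun y => u y / dirichletGreen Λ b b) = fun y => (dirichletGreen Λ b b)⁻¹ * u y from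
          funext fun y => by rw [div_eq_inv_mul], latticeLaplacian_const_mul, hu_harm y hy, mul_zero]
      · intro y _; exact (div_le_one hGpos).2 (hu_le y)
      · intro y hy hyR
        have hy' := (mem_latticeOuterBoundary_iff.1 hy)
        obtain ⟨v, hv, hadj⟩ := hy'.2
        by_cases hyΛ : y ∈ Λ
        · -- then `y ∈ F`, adjacent to `v ∈ Λ ∖ F`: beyond radius `R`
          have hyF : y ∈ F := by
            by_contra hyF; exact hy'.1 (Finset.mem_sdiff.2 ⟨hyΛ, hyF⟩)
          have := hFentr y hyF v (Finset.mem_sdiff.1 hv).1 (Finset.mem_sdiff.1 hv).2 hadj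
          linarith
        · rw [hu_off y hyΛ, zero_div]
    · -- `G(b,b) = 0`: then `b ∉ Λ` and `u ≡ 0`
      have hb : b ∉ Λ := fun hb => (dirichletGreen_diag_pos hb).ne' hG0'.symm
      simp only [hu, dirichletGreen_of_not_mem_right Λ w hb,
        dirichletGreen_of_not_mem_right (Λ \ F) w (fun h => hb (Finset.mem_sdiff.1 h).1), sub_zero, ← hG0',
        mul_zero, le_refl]
  -- Step 2: maximum principle on `N`
  have hNfin : (↑N : Set (Site 2)).Finite := N.finite_toSet
  have hNsub : (↑N : Set (Site 2)) ⊆ ↑(Λ \ F) := fun y hy => hN hy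
  refine (IsLatticeHarmonicOn.subharmonicOn fun y hy => hu_harm y (hNsub hy)).le_of_forall_boundary_le hNfin
    (M := ε * dirichletGreen Λ b b) (fun w hw => ?_) x hx
  obtain ⟨hwN, y, hy, hadj⟩ := mem_latticeOuterBoundary_iff.1 hw
  by_cases hwΛ : w ∈ Λ
  · obtain ⟨hwF, hwd⟩ := hNmouth y hy w hwΛ hwN hadj
    exact step1 w (Finset.mem_sdiff.2 ⟨hwΛ, hwF⟩) hwd
  · rw [hu_off w hwΛ]
    exact mul_nonneg (mul_nonneg beurlingConst_pos.le (Real.rpow_nonneg (by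
      have : (0 : ℝ) ≤ 12 / (M - 2) := by apply div_nonneg <;> linarith
      exact this) _)) hG0

/-- **Inner dead end.** The mirror statement: `F ⊆ Λ` is entered only inside radius `r`
(`|δz - z₀| < r` for `z ∈ F` adjacent to `Λ ∖ F`), `b ∈ N ⊆ Λ ∖ F`, and every
site of `N` with a `Λ`-neighbour outside `N` lies beyond radius `R`. Then
`G_Λ(x,b) - G_{Λ∖F}(x,b) ≤ ε(M) G_Λ(b,b)` on all of `Λ ∖ F`: first `G_Λ(·,b) ≤ ε G_Λ(b,b)` at the
entrances of `F` (harmonic on `Λ ∖ N` off the pole, vanishing on `∂(Λ ∖ N)` inside radius `R`,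
`le_near_wall`), then the maximum principle on `Λ ∖ F` for the correction, whose boundary values are
`G_Λ(z,b)` at the entrances and `0` off `Λ`. [folklore] -/
theorem sub_sdiff_le_of_inner {δ r R M : ℝ} {Λ F N : Finset (Site 2)} (hΛ : HoleFree (↑Λ : Set (Site 2)))
    {z₀ : ℂ} {p : Site 2} (hp : p ∉ Λ) (hpz : dist (meshPoint δ p) z₀ ≤ r + δ)
    (hδ : 0 < δ) (hr : δ ≤ r) (hM : 2 < M) (hR : M * r ≤ R) (hN : N ⊆ Λ \ F)
    (hFentr : ∀ z ∈ F, ∀ x ∈ Λ, x ∉ F → (zdGraph 2).Adj x z → dist (meshPoint δ z) z₀ < r)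
    (hNmouth : ∀ y ∈ N, ∀ w ∈ Λ, w ∉ N → (zdGraph 2).Adj y w → R < dist (meshPoint δ y) z₀)
    {b : Site 2} (hb : b ∈ N) {x : Site 2} (hx : x ∈ Λ \ F) :
    dirichletGreen Λ x b - dirichletGreen (Λ \ F) x b ≤
      beurlingConst * (12 / (M - 2)) ^ beurlingExp * dirichletGreen Λ b b := by
  set ε : ℝ := beurlingConst * (12 / (M - 2)) ^ beurlingExp with hε
  have hG0 := dirichletGreen_nonneg two_pos Λ b b
  have hbΛ : b ∈ Λ := (Finset.mem_sdiff.1 (hN hb)).1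
  have hGpos : 0 < dirichletGreen Λ b b := dirichletGreen_diag_pos hbΛ
  -- Step 1: `G_Λ(z,b) ≤ ε G(b,b)` for `z ∈ Λ ∖ N` within `r + δ` of the centre
  have step1 : ∀ z ∈ Λ, z ∉ N → dist (meshPoint δ z) z₀ < r + δ → dirichletGreen Λ z b ≤ ε * dirichletGreen Λ b b := by
    intro z hzΛ hzN hzd
    have hT : ((↑Λ : Set (Site 2)) \ ↑N) ⊆ ↑Λ := Set.sdiff_subset
    have key := le_near_wall hΛ hT (h := fun y => dirichletGreen Λ y b / dirichletGreen Λ b b) ?_ ?_ ?_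
      hp hpz hδ hr hM hR (x := z) ⟨hzΛ, hzN⟩ hzd
    · rwa [div_le_iff₀ hGpos] at key
    · intro y hy
      rw [show (fun y => dirichletGreen Λ y b / dirichletGreen Λ b b) =
          fun y => (dirichletGreen Λ b b)⁻¹ * dirichletGreen Λ y b from funext fun y => by rw [div_eq_inv_mul],
        latticeLaplacian_const_mul,
        isLatticeHarmonicOn_dirichletGreen_off_pole Λ b y ⟨hy.1, fun h => hy.2 (by rw [Set.mem_singleton_iff.1 h]; exact hb)⟩,
        mul_zero]
    · intro y _; exact (div_le_one hGpos).2 (dirichletGreen_le_diag Λ y b)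
    · intro y hy hyR
      obtain ⟨hyT, v, hv, hadj⟩ := mem_latticeOuterBoundary_iff.1 hy
      by_cases hyΛ : y ∈ Λ
      · have hyN : y ∈ N := by by_contra hyN; exact hyT ⟨hyΛ, hyN⟩
        have := hNmouth y hyN v hv.1 hv.2 hadj.symm
        linarith
      · rw [dirichletGreen_of_not_mem_left Λ hyΛ, zero_div]
  -- Step 2: maximum principle on `Λ ∖ F` for the correction
  set u : Site 2 → ℝ := fun x => dirichletGreen Λ x b - dirichletGreen (Λ \ F) x b with hu
  have hu_harm : IsLatticeHarmonicOn u ↑(Λ \ F) := isLatticeHarmonicOn_dirichletGreen_sub Finset.sdiff_subset b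
  refine hu_harm.subharmonicOn.le_of_forall_boundary_le (Λ \ F).finite_toSet (M := ε * dirichletGreen Λ b b)
    (fun w hw => ?_) x hx
  obtain ⟨hwT, y, hy, hadj⟩ := mem_latticeOuterBoundary_iff.1 hw
  have hy' := Finset.mem_sdiff.1 (show y ∈ Λ \ F from hy)
  have hw0 : dirichletGreen (Λ \ F) w b = 0 := dirichletGreen_of_not_mem_left _ hwT b
  simp only [hu, hw0, sub_zero]
  by_cases hwΛ : w ∈ Λ
  · have hwF : w ∈ F := by by_contra hwF; exact hwT (Finset.mem_sdiff.2 ⟨hwΛ, hwF⟩)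
    have hwd := hFentr w hwF y hy'.1 hy'.2 hadj
    have hwN : w ∉ N := fun hwN => (Finset.mem_sdiff.1 (hN hwN)).2 hwF
    exact step1 w hwΛ hwN (by linarith)
  · rw [dirichletGreen_of_not_mem_left Λ hwΛ]
    exact mul_nonneg (mul_nonneg beurlingConst_pos.le (Real.rpow_nonneg (by
      have : (0 : ℝ) ≤ 12 / (M - 2) := by apply div_nonneg <;> linarith
      exact this) _)) hG0

/-! ## §5 Assembly under the collar clauses of the registered signature -/

/-- **The far detour costs at most `ε(M) G_Λ(b,b)`** (worker sub-goal `stub_killedWalkFarDetour` of stub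
`stub_killedWalkCollarBound`; the part of the killed-walk collar bound settled by the tree's weak
Beurling estimate). Under the collar clauses of the registered signature with `M > 2`:
`G_Λ(a,b) - G_{Λ∖H}(a,b) ≤ C_B (12/(M-2))^{β_B} G_Λ(b,b)` and the same at `a = b` (the DIAGONAL case of
the stub: `G_{Λ∖H}(b,b) ≥ (1 - ε(M)) G_Λ(b,b)`). Proof: `H ∩ Λ` lies in the far set `F` (sites joined off
`V` to `H`), so `G_{Λ∖H} ≥ G_{Λ∖F}`; the near set `N ∋ a, b` (sites joined to `a` off `V`) misses `F`;
a `Λ`-neighbour outside `F` of a far site, or outside `N` of a near site, lies in `V`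
(`mem_collar_of_adj_far/near`), so the mouth clauses put the entrances of `F` beyond `R` and the exits
of `N` within `r + δ` (first disjunct: `sub_sdiff_le_of_outer`) or the other way round
(`sub_sdiff_le_of_inner`). What is NOT settled here is the comparison with `G_Λ(a,b)` in place of
`G_Λ(b,b)` for `a ≠ b` (the two-way crossing of the collar by the conditioned walk). [folklore] -/
theorem stub_killedWalkFarDetour : ∀ (M : ℝ), 2 < M → ∀ (δ : ℝ) (Λ : Finset (Site 2)) (a b : Site 2), 0 < δ →
    HoleFree (↑Λ : Set (Site 2)) →
    ∀ (z₀ : ℂ) (r R : ℝ) (H : Finset (Site 2)), δ ≤ r → M * r ≤ R →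
      (∃ V : Finset (Site 2), V ⊆ Λ ∧
        (∀ x ∈ V, r ≤ dist (meshPoint δ x) z₀ ∧ dist (meshPoint δ x) z₀ ≤ R) ∧
        (∃ p : (zdGraph 2).Walk a b, ∀ x ∈ p.support, x ∈ Λ ∧ x ∉ V) ∧
        (∀ y, (∃ p : (zdGraph 2).Walk a y, ∀ x ∈ p.support, x ∈ Λ ∧ x ∉ V) → y ∉ H) ∧
        (∀ x ∈ V, x ∉ H) ∧
        (∃ p : Site 2, p ∉ Λ ∧ dist (meshPoint δ p) z₀ ≤ r + δ) ∧
        ((∀ x ∈ V, ∀ y ∈ Λ, y ∉ V → (zdGraph 2).Adj x y →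
            ((∃ p : (zdGraph 2).Walk a y, ∀ x ∈ p.support, x ∈ Λ ∧ x ∉ V) →
              dist (meshPoint δ y) z₀ < r) ∧
            ((∃ h ∈ H, (∃ p : (zdGraph 2).Walk y h, ∀ x ∈ p.support, x ∈ Λ ∧ x ∉ V)) →
              R < dist (meshPoint δ y) z₀)) ∨
         (∀ x ∈ V, ∀ y ∈ Λ, y ∉ V → (zdGraph 2).Adj x y →
            ((∃ p : (zdGraph 2).Walk a y, ∀ x ∈ p.support, x ∈ Λ ∧ x ∉ V) →
              R < dist (meshPoint δ y) z₀) ∧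
            ((∃ h ∈ H, (∃ p : (zdGraph 2).Walk y h, ∀ x ∈ p.support, x ∈ Λ ∧ x ∉ V)) →
              dist (meshPoint δ y) z₀ < r)))) →
      dirichletGreen Λ a b - dirichletGreen (Λ \ H) a b ≤
          WeakBeurling.beurlingConst * (12 / (M - 2)) ^ WeakBeurling.beurlingExp * dirichletGreen Λ b b ∧
        dirichletGreen Λ b b - dirichletGreen (Λ \ H) b b ≤
          WeakBeurling.beurlingConst * (12 / (M - 2)) ^ WeakBeurling.beurlingExp * dirichletGreen Λ b b := by
  intro M hM δ Λ a b hδ hΛ z₀ r R H hr hR hV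
  obtain ⟨V, -, -, ⟨p₀, hp₀⟩, hNearH, hVH, ⟨p, hp, hpz⟩, hdisj⟩ := hV
  classical
  set F : Finset (Site 2) :=
    Λ.filter (fun y => ∃ h ∈ H, ∃ q : (zdGraph 2).Walk y h, ∀ x ∈ q.support, x ∈ Λ ∧ x ∉ V) with hFdef
  set N : Finset (Site 2) :=
    Λ.filter (fun y => ∃ q : (zdGraph 2).Walk a y, ∀ x ∈ q.support, x ∈ Λ ∧ x ∉ V) with hNdef
  have hHF : ∀ e ∈ H, e ∈ Λ → e ∈ F := fun e he heΛ => Finset.mem_filter.2 ⟨heΛ, far_of_mem hVH he heΛ⟩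
  have hNF : N ⊆ Λ \ F := fun y hy => by
    have hy' := Finset.mem_filter.1 hy
    exact Finset.mem_sdiff.2 ⟨hy'.1, fun hyF => not_far_of_near hNearH hy'.2 (Finset.mem_filter.1 hyF).2⟩
  have haN : a ∈ N := Finset.mem_filter.2 ⟨(hp₀ a p₀.start_mem_support).1, joined_refl (hp₀ a p₀.start_mem_support)⟩
  have hbN : b ∈ N := Finset.mem_filter.2 ⟨(hp₀ b p₀.end_mem_support).1, p₀, hp₀⟩
  -- a `Λ`-neighbour outside `F` of a far site is a collar site, the far site is off the collar
  have hFV : ∀ z ∈ F, ∀ x ∈ Λ, x ∉ F → (zdGraph 2).Adj x z →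
      x ∈ V ∧ z ∈ Λ ∧ z ∉ V ∧ ∃ h ∈ H, ∃ q : (zdGraph 2).Walk z h, ∀ x ∈ q.support, x ∈ Λ ∧ x ∉ V := by
    intro z hz x hxΛ hxF hadj
    obtain ⟨hzΛ, hzF⟩ := Finset.mem_filter.1 hz
    obtain ⟨h, hh, hq⟩ := hzF
    exact ⟨mem_collar_of_adj_far hxΛ (fun h' => hxF (Finset.mem_filter.2 ⟨hxΛ, h'⟩)) hadj ⟨h, hh, hq⟩, hzΛ,
      (mem_of_joined_left hq).2, h, hh, hq⟩
  -- a `Λ`-neighbour outside `N` of a near site is a collar site off `F`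
  have hNV : ∀ y ∈ N, ∀ w ∈ Λ, w ∉ N → (zdGraph 2).Adj y w →
      w ∈ V ∧ w ∉ F ∧ y ∈ Λ ∧ y ∉ V ∧ ∃ q : (zdGraph 2).Walk a y, ∀ x ∈ q.support, x ∈ Λ ∧ x ∉ V := by
    intro y hy w hwΛ hwN hadj
    obtain ⟨hyΛ, hyN⟩ := Finset.mem_filter.1 hy
    have hwV : w ∈ V := mem_collar_of_adj_near hwΛ (fun h' => hwN (Finset.mem_filter.2 ⟨hwΛ, h'⟩)) hadj.symm hyN
    refine ⟨hwV, fun hwF => ?_, hyΛ, (mem_of_joined_right hyN).2, hyN⟩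
    obtain ⟨h, -, hq⟩ := (Finset.mem_filter.1 hwF).2
    exact (mem_of_joined_left hq).2 hwV
  -- reduce `H` to `F`
  have hred : ∀ x, dirichletGreen Λ x b - dirichletGreen (Λ \ H) x b ≤ dirichletGreen Λ x b - dirichletGreen (Λ \ F) x b :=
    fun x => by linarith [dirichletGreen_sdiff_le_sdiff hHF x b]
  rcases hdisj with hcl | hcl
  · have hFentr : ∀ z ∈ F, ∀ x ∈ Λ, x ∉ F → (zdGraph 2).Adj x z → R < dist (meshPoint δ z) z₀ := by
      intro z hz x hxΛ hxF hadj
      obtain ⟨hxV, hzΛ, hzV, hfar⟩ := hFV z hz x hxΛ hxF hadj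
      exact (hcl x hxV z hzΛ hzV hadj).2 hfar
    have hNmouth : ∀ y ∈ N, ∀ w ∈ Λ, w ∉ N → (zdGraph 2).Adj y w → w ∉ F ∧ dist (meshPoint δ w) z₀ < r + δ := by
      intro y hy w hwΛ hwN hadj
      obtain ⟨hwV, hwF, hyΛ, hyV, hnear⟩ := hNV y hy w hwΛ hwN hadj
      have h1 := (hcl w hwV y hyΛ hyV hadj.symm).1 hnear
      have h2 := abs_dist_sub_dist_le_of_adj hδ z₀ hadj
      rw [abs_le] at h2
      exact ⟨hwF, by linarith [h2.2]⟩
    exact ⟨(hred a).trans (sub_sdiff_le_of_outer hΛ hp hpz hδ hr hM hR hNF hFentr hNmouth b haN),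
      (hred b).trans (sub_sdiff_le_of_outer hΛ hp hpz hδ hr hM hR hNF hFentr hNmouth b hbN)⟩
  · have hFentr : ∀ z ∈ F, ∀ x ∈ Λ, x ∉ F → (zdGraph 2).Adj x z → dist (meshPoint δ z) z₀ < r := by
      intro z hz x hxΛ hxF hadj
      obtain ⟨hxV, hzΛ, hzV, hfar⟩ := hFV z hz x hxΛ hxF hadj
      exact (hcl x hxV z hzΛ hzV hadj).2 hfar
    have hNmouth : ∀ y ∈ N, ∀ w ∈ Λ, w ∉ N → (zdGraph 2).Adj y w → R < dist (meshPoint δ y) z₀ := by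
      intro y hy w hwΛ hwN hadj
      obtain ⟨hwV, -, hyΛ, hyV, hnear⟩ := hNV y hy w hwΛ hwN hadj
      exact (hcl w hwV y hyΛ hyV hadj.symm).1 hnear
    exact ⟨(hred a).trans (sub_sdiff_le_of_inner hΛ hp hpz hδ hr hM hR hNF hFentr hNmouth hbN (hNF haN)),
      (hred b).trans (sub_sdiff_le_of_inner hΛ hp hpz hδ hr hM hR hNF hFentr hNmouth hbN (hNF hbN))⟩

end Summit.CriticalPhenomena.SAWScalingLimit.Theorems.FKGToTraversalBound.ExcursionDomination.KilledWalkCollar
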